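import Summits.AtomisticToContinuum.Crystallization.Theorems.PhononSlackCertificatesPeriodicGivenLayeredClosing4

/-!
# `PeriodicGivenLayered` (stmt-AtomisticToContinuum-11779), line `Sketch`, stub `stub_closing` — part 5

The **block decomposition** for Part B of the density closing (lead prover-line-stmt-AtomisticToContinuum-11779-0):
for a fault-free Hägg word `s`, admissible heights `z` (`a ∈ [47/50, 1]`, increments in
`[39a/50, 17a/20]`) and the decay `|Φ(H, δ)| ≤ C/H⁴` (`|H| ≥ 7/10`) of the layer sums,

  `|Σ_{m ∈ [m₁, m₁+n]} T(m) − 2 F_n(Δ)| ≤ 16 C`     (`clo_block_decomposition`),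

`T(m) = Σ'_{m'≠m} Φ(z m' − z m, L m' − L m)` the registry energy of layer `m`, `F_n` the alternating
block energy of `stub_convexity` in the increments `Δ l = z (m₁+l+1) − z (m₁+l)`. The in-block pairs
give `2 F_n` (`clo_pairs_eq_two_mul_block`, part 4); the interaction of the block with the layers
outside it (`clo_tail_bound`) is at most `(4/3)·C·κ⁴·Σ_{i ≤ n} ((n+1−i)⁻³ + (i+1)⁻³) ≤ 16 C` by the
`k⁻⁴` decay along the stacking axis (`|z m' − z m| ≥ (39a/50)|m' − m|`, `(50/(39a))⁴ ≤ 4`).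
-/

noncomputable section

namespace Summit.AtomisticToContinuum.Crystallization.Theorems.LayeredHull

open scoped BigOperators
open Finset Filter Literature.MathematicalPhysics.StatisticalMechanics

/-! ## Elementary sums -/

/-- `Σ_{k<K} (k+1)⁻³ ≤ 3/2` (telescoping `x⁻³ ≤ ((x−1)⁻² − x⁻²)/2` for `x ≥ 2`). [folklore] -/
theorem clo_sum_inv_cube_le (K : ℕ) : ∑ k ∈ Finset.range K, ((k : ℝ) + 1)⁻¹ ^ 3 ≤ 3 / 2 := by
  have key : ∀ x : ℝ, 2 ≤ x → x⁻¹ ^ 3 ≤ 1 / 2 * ((x - 1)⁻¹ ^ 2 - x⁻¹ ^ 2) := by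
    intro x hx
    have hx0 : 0 < x := by linarith
    have hx1 : 0 < x - 1 := by linarith
    rw [inv_pow, inv_pow, inv_pow, inv_eq_one_div, inv_eq_one_div, inv_eq_one_div,
      div_sub_div _ _ (by positivity) (by positivity), div_mul_eq_mul_div, one_mul,
      div_div, div_le_div_iff₀ (by positivity) (by positivity)]
    nlinarith [mul_pos hx1 hx1, mul_pos hx0 hx1, mul_pos hx0 hx0]
  have hstrong : ∀ K : ℕ, ∑ k ∈ Finset.range (K + 1), ((k : ℝ) + 1)⁻¹ ^ 3 ≤
      1 + 1 / 2 * (1 - ((K : ℝ) + 1)⁻¹ ^ 2) := by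
    intro K
    induction K with
    | zero => simp
    | succ K ih =>
      rw [Finset.sum_range_succ]
      have hk := key ((K : ℝ) + 1 + 1) (by have : (0 : ℝ) ≤ K := Nat.cast_nonneg K; linarith)
      rw [show ((K : ℝ) + 1 + 1 - 1) = (K : ℝ) + 1 by ring] at hk
      push_cast
      linarith
  rcases K with _ | K
  · norm_num
  · have h := hstrong K
    have : 0 ≤ ((K : ℝ) + 1)⁻¹ ^ 2 := by positivity
    linarith

/-- The tail of `j⁻⁴` beyond `d ≥ 1`, as a `tsum` of the masked sequence:
`Σ'_{j ≥ d} c·j⁻⁴ ≤ (4/3)·c·d⁻³` for `c ≥ 0`. [folklore] -/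
theorem clo_tsum_tail_le {c : ℝ} (hc : 0 ≤ c) (d : ℕ) (hd : 1 ≤ d) :
    ∑' j : ℕ, (if j < d then (0 : ℝ) else c * ((j : ℝ))⁻¹ ^ 4) ≤ 4 / 3 * c * ((d : ℝ))⁻¹ ^ 3 := by
  have hs : Summable fun j : ℕ => c * ((j : ℝ))⁻¹ ^ 4 := by
    have := (Real.summable_nat_pow_inv.2 (by norm_num : 1 < 4)).mul_left c
    refine this.congr fun j => ?_
    rw [inv_pow]
  have hs' : Summable fun j : ℕ => if j < d then (0 : ℝ) else c * ((j : ℝ))⁻¹ ^ 4 := by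
    refine Summable.of_norm_bounded hs fun j => ?_
    split_ifs
    · simp only [norm_zero]; positivity
    · rw [Real.norm_eq_abs, abs_of_nonneg (by positivity)]
  rw [← hs'.sum_add_tsum_nat_add d]
  have h0 : ∑ j ∈ Finset.range d, (if j < d then (0 : ℝ) else c * ((j : ℝ))⁻¹ ^ 4) = 0 :=
    Finset.sum_eq_zero fun j hj => by rw [if_pos (Finset.mem_range.1 hj)]
  rw [h0, zero_add]
  have h1 : ∀ j : ℕ, (if j + d < d then (0 : ℝ) else c * (((j + d : ℕ) : ℝ))⁻¹ ^ 4) =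
      c * (((d : ℝ) + j))⁻¹ ^ 4 := fun j => by
    rw [if_neg (by omega)]; push_cast; ring_nf
  simp only [h1]
  refine Real.tsum_le_of_sum_range_le (fun j => by positivity) fun J => ?_
  rw [← Finset.mul_sum]
  have := clo_sum_inv_pow_four_le d hd J
  nlinarith

/-! ## Heights along the stacking axis -/

/-- `|z m' − z m| ≥ (39a/50)|m' − m|` for admissible heights. [folklore] -/
theorem clo_height_abs {a : ℝ} {z : ℤ → ℝ}
    (hz : ∀ m : ℤ, 39 / 50 * a ≤ z (m + 1) - z m ∧ z (m + 1) - z m ≤ 17 / 20 * a) (m m' : ℤ) :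
    39 / 50 * a * |((m' - m : ℤ) : ℝ)| ≤ |z m' - z m| := by
  rcases le_or_gt m m' with h | h
  · obtain ⟨k, rfl⟩ : ∃ k : ℕ, m' = m + k := ⟨(m' - m).toNat, by omega⟩
    have := (clo_height_add hz m k).1
    rw [show m + (k : ℤ) - m = k by ring]
    push_cast
    rw [abs_of_nonneg (Nat.cast_nonneg k), abs_of_nonneg (by
      have ha : 0 ≤ 39 / 50 * a * (k : ℝ) := by
        have := (hz m).1; have := (hz m).2; nlinarith [Nat.cast_nonneg (α := ℝ) k]
      linarith)]
    exact this
  · obtain ⟨k, rfl⟩ : ∃ k : ℕ, m' = m - k := ⟨(m - m').toNat, by omega⟩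
    have := (clo_height_sub hz m k).1
    rw [show m - (k : ℤ) - m = -k by ring]
    push_cast
    rw [abs_neg, abs_of_nonneg (Nat.cast_nonneg k), abs_sub_comm, abs_of_nonneg (by
      have ha : 0 ≤ 39 / 50 * a * (k : ℝ) := by
        have := (hz m).1; have := (hz m).2; nlinarith [Nat.cast_nonneg (α := ℝ) k]
      linarith)]
    exact this

/-! ## The interaction of a block with the layers outside it -/
set_option maxHeartbeats 400000 in
/-- **One layer against the outside of the block.** For `m = m₁ + i`, `0 ≤ i ≤ n`, the registry terms
of layer `m` against the layers outside `[m₁, m₁+n]` sum to at most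
`(4/3)·4C·((n+1−i)⁻³ + (i+1)⁻³)` in absolute value. [folklore] -/
theorem clo_tail_one {a : ℝ} (ha : 47 / 50 ≤ a) (s : ℤ → ℤ) {z : ℤ → ℝ}
    (hz : ∀ m : ℤ, 39 / 50 * a ≤ z (m + 1) - z m ∧ z (m + 1) - z m ≤ 17 / 20 * a) {C : ℝ}
    (hdecay : ∀ (H : ℝ) (δ : ℤ), 7 / 10 ≤ |H| → |layerInteraction lennardJones a H δ 1| ≤ C / H ^ 4)
    (m₁ : ℤ) (n i : ℕ) (hi : i ≤ n) :
    |∑' m' : ℤ, (if m' ∈ Finset.Ico m₁ (m₁ + ((n + 1 : ℕ) : ℤ)) then (0 : ℝ) else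
        (if m' = m₁ + i then (0 : ℝ) else
          layerInteraction lennardJones a (z m' - z (m₁ + i)) (haggLabel s m' - haggLabel s (m₁ + i)) 1))| ≤
      4 / 3 * (4 * C) * ((((n + 1 - i : ℕ) : ℝ))⁻¹ ^ 3 + (((i + 1 : ℕ) : ℝ))⁻¹ ^ 3) := by
  classical
  have hC : 0 ≤ C := by
    have h1 := hdecay 1 0 (by norm_num)
    have : (0 : ℝ) ≤ C / 1 ^ 4 := (abs_nonneg _).trans h1
    simpa using this
  have ha0 : 0 < 39 / 50 * a := by linarith
  -- the comparison sequence `w m' = [m' ∉ block] · 4C · |m' − m|⁻⁴`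
  set m : ℤ := m₁ + i with hm
  have hwbound : ∀ m' : ℤ, ‖(if m' ∈ Finset.Ico m₁ (m₁ + ((n + 1 : ℕ) : ℤ)) then (0 : ℝ) else
      (if m' = m then (0 : ℝ) else
        layerInteraction lennardJones a (z m' - z m) (haggLabel s m' - haggLabel s m) 1))‖ ≤
      (if m' ∈ Finset.Ico m₁ (m₁ + ((n + 1 : ℕ) : ℤ)) then (0 : ℝ) else
        4 * C * |((m' - m : ℤ) : ℝ)|⁻¹ ^ 4) := by
    intro m'
    by_cases hB : m' ∈ Finset.Ico m₁ (m₁ + ((n + 1 : ℕ) : ℤ))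
    · rw [if_pos hB, if_pos hB, norm_zero]
    · rw [if_neg hB, if_neg hB]
      have hne : m' ≠ m := by
        intro h'; apply hB; rw [h', hm, Finset.mem_Ico]; constructor <;> push_cast <;> omega
      rw [if_neg hne, Real.norm_eq_abs]
      have hk1 : (1 : ℝ) ≤ |((m' - m : ℤ) : ℝ)| := by
        rw [← Int.cast_abs]; exact_mod_cast Int.one_le_abs (sub_ne_zero.2 hne)
      have hH : 39 / 50 * a * |((m' - m : ℤ) : ℝ)| ≤ |z m' - z m| := clo_height_abs hz m m'
      have hH7 : 7 / 10 ≤ |z m' - z m| := by nlinarith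
      have hd := hdecay (z m' - z m) (haggLabel s m' - haggLabel s m) hH7
      refine hd.trans ?_
      -- `C / H⁴ ≤ 4C |m'−m|⁻⁴` from `H ≥ (39a/50)|m'−m|` and `(50/(39a))⁴ ≤ 4`
      have hHpos : 0 < |z m' - z m| := by linarith
      rw [show (z m' - z m) ^ 4 = |z m' - z m| ^ 4 by rw [pow_abs, abs_of_nonneg (by positivity)],
        div_le_iff₀ (by positivity), inv_pow]
      have hk0 : 0 < |((m' - m : ℤ) : ℝ)| := by linarith
      have e4 : ((39 : ℝ) / 50 * a * |((m' - m : ℤ) : ℝ)|) ^ 4 ≤ |z m' - z m| ^ 4 :=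
        pow_le_pow_left₀ (by positivity) hH 4
      have ha4 : (1 : ℝ) / 4 ≤ (39 / 50 * a) ^ 4 := by
        have h1 : (7332 : ℝ) / 10000 ≤ 39 / 50 * a := by linarith
        calc (1 : ℝ) / 4 ≤ ((7332 : ℝ) / 10000) ^ 4 := by norm_num
          _ ≤ (39 / 50 * a) ^ 4 := pow_le_pow_left₀ (by norm_num) h1 4
      calc C = 4 * C * (|((m' - m : ℤ) : ℝ)| ^ 4)⁻¹ * ((1 / 4) * |((m' - m : ℤ) : ℝ)| ^ 4) := by
            field_simp
        _ ≤ 4 * C * (|((m' - m : ℤ) : ℝ)| ^ 4)⁻¹ * ((39 / 50 * a) ^ 4 * |((m' - m : ℤ) : ℝ)| ^ 4) := by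
            apply mul_le_mul_of_nonneg_left _ (by positivity)
            exact mul_le_mul_of_nonneg_right ha4 (by positivity)
        _ = 4 * C * (|((m' - m : ℤ) : ℝ)| ^ 4)⁻¹ * ((39 : ℝ) / 50 * a * |((m' - m : ℤ) : ℝ)|) ^ 4 := by ring
        _ ≤ 4 * C * (|((m' - m : ℤ) : ℝ)| ^ 4)⁻¹ * |z m' - z m| ^ 4 :=
            mul_le_mul_of_nonneg_left e4 (by positivity)
  -- summability of the comparison sequence over `ℤ`
  have hwsum : Summable fun m' : ℤ => (if m' ∈ Finset.Ico m₁ (m₁ + ((n + 1 : ℕ) : ℤ)) then (0 : ℝ) else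
      4 * C * |((m' - m : ℤ) : ℝ)|⁻¹ ^ 4) := by
    have hbase : Summable fun k : ℤ => 4 * C * |((k : ℤ) : ℝ)|⁻¹ ^ 4 := by
      have hn : Summable fun j : ℕ => 4 * C * ((j : ℝ))⁻¹ ^ 4 := by
        have := (Real.summable_nat_pow_inv.2 (by norm_num : 1 < 4)).mul_left (4 * C)
        exact this.congr fun j => by rw [inv_pow]
      refine Summable.of_nat_of_neg_add_one (f := fun k : ℤ => 4 * C * |((k : ℤ) : ℝ)|⁻¹ ^ 4) ?_ ?_
      · exact hn.congr fun j => by simp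
      · refine ((summable_nat_add_iff 1).2 hn).congr fun j => ?_
        push_cast
        rw [abs_neg, abs_of_nonneg (by positivity)]
    have hshift : Summable fun m' : ℤ => 4 * C * |((m' - m : ℤ) : ℝ)|⁻¹ ^ 4 :=
      (Equiv.subRight m).summable_iff.2 hbase
    refine Summable.of_norm_bounded hshift fun m' => ?_
    split_ifs
    · simp only [norm_zero]; positivity
    · rw [Real.norm_eq_abs, abs_of_nonneg (by positivity)]
  -- compare
  refine (tsum_of_norm_bounded hwsum.hasSum hwbound).trans ?_
  -- evaluate the comparison sum: split at `m`, two one-sided `j⁻⁴` tails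
  rw [clo_tsum_int_split _ m hwsum]
  have hup : ∀ j : ℕ, (if m + (j : ℤ) ∈ Finset.Ico m₁ (m₁ + ((n + 1 : ℕ) : ℤ)) then (0 : ℝ) else
      4 * C * |((m + (j : ℤ) - m : ℤ) : ℝ)|⁻¹ ^ 4) =
      (if j < n + 1 - i then (0 : ℝ) else 4 * C * ((j : ℝ))⁻¹ ^ 4) := by
    intro j
    have e : ((m + (j : ℤ) - m : ℤ) : ℝ) = j := by push_cast; ring
    rw [e, abs_of_nonneg (Nat.cast_nonneg j)]
    congr 1
    rw [hm, Finset.mem_Ico]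
    apply propext
    constructor
    · rintro ⟨-, h2⟩; push_cast at h2; omega
    · intro hj; constructor <;> push_cast <;> omega
  have hdown : ∀ j : ℕ, (if m - ((j + 1 : ℕ) : ℤ) ∈ Finset.Ico m₁ (m₁ + ((n + 1 : ℕ) : ℤ)) then (0 : ℝ) else
      4 * C * |((m - ((j + 1 : ℕ) : ℤ) - m : ℤ) : ℝ)|⁻¹ ^ 4) =
      (if j + 1 < i + 1 then (0 : ℝ) else 4 * C * (((j + 1 : ℕ) : ℝ))⁻¹ ^ 4) := by
    intro j
    have e : ((m - ((j + 1 : ℕ) : ℤ) - m : ℤ) : ℝ) = -((j + 1 : ℕ) : ℝ) := by push_cast; ring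
    rw [e, abs_neg, abs_of_nonneg (Nat.cast_nonneg _)]
    congr 1
    rw [hm, Finset.mem_Ico]
    apply propext
    constructor
    · rintro ⟨h1, -⟩; push_cast at h1; omega
    · intro hj; constructor <;> push_cast <;> omega
  simp only [hup, hdown]
  have h1 : ∑' j : ℕ, (if j < n + 1 - i then (0 : ℝ) else 4 * C * ((j : ℝ))⁻¹ ^ 4) ≤
      4 / 3 * (4 * C) * (((n + 1 - i : ℕ) : ℝ))⁻¹ ^ 3 :=
    clo_tsum_tail_le (by positivity) (n + 1 - i) (by omega)
  have h2 : ∑' j : ℕ, (if j + 1 < i + 1 then (0 : ℝ) else 4 * C * (((j + 1 : ℕ) : ℝ))⁻¹ ^ 4) ≤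
      4 / 3 * (4 * C) * (((i + 1 : ℕ) : ℝ))⁻¹ ^ 3 := by
    have h := clo_tsum_tail_le (c := 4 * C) (by positivity) (i + 1) (by omega)
    have hs : Summable fun j : ℕ => if j < i + 1 then (0 : ℝ) else 4 * C * ((j : ℝ))⁻¹ ^ 4 := by
      have hn : Summable fun j : ℕ => 4 * C * ((j : ℝ))⁻¹ ^ 4 := by
        have := (Real.summable_nat_pow_inv.2 (by norm_num : 1 < 4)).mul_left (4 * C)
        exact this.congr fun j => by rw [inv_pow]
      refine Summable.of_norm_bounded hn fun j => ?_
      split_ifs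
      · simp only [norm_zero]; positivity
      · rw [Real.norm_eq_abs, abs_of_nonneg (by positivity)]
    rw [hs.tsum_eq_zero_add] at h
    simpa using h
  linarith

/-! ## The block decomposition -/

/-- Splitting the registry energy of layer `m` into the block part and the outside part. [folklore] -/
theorem clo_layer_split (a : ℝ) (s : ℤ → ℤ) (z : ℤ → ℝ) (B : Finset ℤ) (m : ℤ)
    (hsum : Summable fun m' : ℤ => if m' = m then (0 : ℝ) else
      layerInteraction lennardJones a (z m' - z m) (haggLabel s m' - haggLabel s m) 1) :
    (∑' m' : ℤ, if m' = m then (0 : ℝ) else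
        layerInteraction lennardJones a (z m' - z m) (haggLabel s m' - haggLabel s m) 1) =
      (∑ m' ∈ B, if m' = m then (0 : ℝ) else
        layerInteraction lennardJones a (z m' - z m) (haggLabel s m' - haggLabel s m) 1) +
      ∑' m' : ℤ, (if m' ∈ B then (0 : ℝ) else (if m' = m then (0 : ℝ) else
        layerInteraction lennardJones a (z m' - z m) (haggLabel s m' - haggLabel s m) 1)) := by
  classical
  set f : ℤ → ℝ := fun m' => if m' = m then (0 : ℝ) else
      layerInteraction lennardJones a (z m' - z m) (haggLabel s m' - haggLabel s m) 1 with hf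
  have hg : Summable fun m' : ℤ => if m' ∈ B then f m' else 0 :=
    summable_of_ne_finset_zero (s := B) fun m' hm' => if_neg hm'
  have hh : Summable fun m' : ℤ => if m' ∈ B then (0 : ℝ) else f m' := by
    refine Summable.of_norm_bounded hsum.norm fun m' => ?_
    split_ifs <;> simp
  have hsplit : ∀ m', f m' = (if m' ∈ B then f m' else 0) + (if m' ∈ B then (0 : ℝ) else f m') :=
    fun m' => by split_ifs <;> simp
  calc ∑' m', f m' = ∑' m', ((if m' ∈ B then f m' else 0) + (if m' ∈ B then (0 : ℝ) else f m')) :=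
        tsum_congr hsplit
    _ = (∑' m', if m' ∈ B then f m' else 0) + ∑' m', (if m' ∈ B then (0 : ℝ) else f m') :=
        hg.tsum_add hh
    _ = (∑ m' ∈ B, f m') + ∑' m', (if m' ∈ B then (0 : ℝ) else f m') := by
        congr 1
        rw [tsum_eq_sum (s := B) fun m' hm' => if_neg hm']
        exact Finset.sum_congr rfl fun m' hm' => if_pos hm'

/-- **Block decomposition.** For a fault-free Hägg word and admissible heights, the registry energies
of the `n + 1` layers `m₁, …, m₁+n` sum to twice the alternating block energy of `stub_convexity` in
the increments `Δ l = z (m₁+l+1) − z (m₁+l)`, up to a boundary-layer term `≤ 16 C` in absolute value.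
[folklore] -/
theorem clo_block_decomposition {a : ℝ} (ha : 47 / 50 ≤ a) {s : ℤ → ℤ} (hs : IsHaggSeq s)
    (h : ∀ m : ℤ, s (m + 1) = -s m) {z : ℤ → ℝ}
    (hz : ∀ m : ℤ, 39 / 50 * a ≤ z (m + 1) - z m ∧ z (m + 1) - z m ≤ 17 / 20 * a) {C : ℝ}
    (hdecay : ∀ (H : ℝ) (δ : ℤ), 7 / 10 ≤ |H| → |layerInteraction lennardJones a H δ 1| ≤ C / H ^ 4)
    (hsum : ∀ m : ℤ, Summable fun m' : ℤ => if m' = m then (0 : ℝ) else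
      layerInteraction lennardJones a (z m' - z m) (haggLabel s m' - haggLabel s m) 1)
    (m₁ : ℤ) (n : ℕ) :
    |(∑ m ∈ Finset.Ico m₁ (m₁ + ((n + 1 : ℕ) : ℤ)), (∑' m' : ℤ, if m' = m then (0 : ℝ) else
          layerInteraction lennardJones a (z m' - z m) (haggLabel s m' - haggLabel s m) 1)) -
      2 * ∑ i ∈ Finset.range n, ∑ j ∈ Finset.Ioc i n, layerInteraction lennardJones a
        (∑ l ∈ Finset.Ico i j, (z (m₁ + l + 1) - z (m₁ + l))) (if Even (j - i) then 0 else 1) 1| ≤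
      16 * C := by
  classical
  have hC : 0 ≤ C := by
    have h1 := hdecay 1 0 (by norm_num)
    have : (0 : ℝ) ≤ C / 1 ^ 4 := (abs_nonneg _).trans h1
    simpa using this
  -- reindex the block by `i < n + 1` and split every layer energy
  rw [clo_sum_Ico_eq_sum_range, ← clo_pairs_eq_two_mul_block hs h a z m₁ n]
  have hlayer : ∀ i ∈ Finset.range (n + 1),
      (∑' m' : ℤ, if m' = m₁ + (i : ℤ) then (0 : ℝ) else
        layerInteraction lennardJones a (z m' - z (m₁ + i)) (haggLabel s m' - haggLabel s (m₁ + i)) 1) =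
      (∑ j ∈ Finset.range (n + 1), if m₁ + (j : ℤ) = m₁ + (i : ℤ) then (0 : ℝ) else
        layerInteraction lennardJones a (z (m₁ + j) - z (m₁ + i))
          (haggLabel s (m₁ + j) - haggLabel s (m₁ + i)) 1) +
      ∑' m' : ℤ, (if m' ∈ Finset.Ico m₁ (m₁ + ((n + 1 : ℕ) : ℤ)) then (0 : ℝ) else
        (if m' = m₁ + (i : ℤ) then (0 : ℝ) else
          layerInteraction lennardJones a (z m' - z (m₁ + i)) (haggLabel s m' - haggLabel s (m₁ + i)) 1)) := by
    intro i _
    rw [clo_layer_split a s z (Finset.Ico m₁ (m₁ + ((n + 1 : ℕ) : ℤ))) (m₁ + i) (hsum _),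
      clo_sum_Ico_eq_sum_range]
  rw [Finset.sum_congr rfl hlayer, Finset.sum_add_distrib, add_sub_cancel_left]
  -- the tails
  refine (Finset.abs_sum_le_sum_abs _ _).trans ?_
  have htail : ∀ i ∈ Finset.range (n + 1),
      |∑' m' : ℤ, (if m' ∈ Finset.Ico m₁ (m₁ + ((n + 1 : ℕ) : ℤ)) then (0 : ℝ) else
        (if m' = m₁ + (i : ℤ) then (0 : ℝ) else
          layerInteraction lennardJones a (z m' - z (m₁ + i)) (haggLabel s m' - haggLabel s (m₁ + i)) 1))| ≤
      4 / 3 * (4 * C) * ((((n + 1 - i : ℕ) : ℝ))⁻¹ ^ 3 + (((i + 1 : ℕ) : ℝ))⁻¹ ^ 3) :=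
    fun i hi => clo_tail_one ha s hz hdecay m₁ n i (Nat.lt_succ_iff.1 (Finset.mem_range.1 hi))
  refine (Finset.sum_le_sum htail).trans ?_
  rw [← Finset.mul_sum, Finset.sum_add_distrib]
  have h1 : ∑ i ∈ Finset.range (n + 1), (((i + 1 : ℕ) : ℝ))⁻¹ ^ 3 ≤ 3 / 2 := by
    have := clo_sum_inv_cube_le (n + 1)
    refine le_trans (le_of_eq (Finset.sum_congr rfl fun i _ => by push_cast; ring)) this
  have h2 : ∑ i ∈ Finset.range (n + 1), (((n + 1 - i : ℕ) : ℝ))⁻¹ ^ 3 ≤ 3 / 2 := by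
    rw [← Finset.sum_range_reflect (fun i => (((i + 1 : ℕ) : ℝ))⁻¹ ^ 3) (n + 1)] at h1
    refine le_trans (le_of_eq (Finset.sum_congr rfl fun i hi => ?_)) h1
    have hi' : i < n + 1 := Finset.mem_range.1 hi
    exact congr_arg (fun k : ℕ => ((k : ℝ))⁻¹ ^ 3) (by omega)
  nlinarith

end Summit.AtomisticToContinuum.Crystallization.Theorems.LayeredHull

end
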